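import Summits.RiemannHypothesis.RiemannHypothesis.Theorems.ScrewManifestCornerLaw
import Summits.RiemannHypothesis.RiemannHypothesis.Theorems.ScrewManifestCurvature

/-!
# Screw manifest certificates: the DIVISOR-PAIR IDENTITY and the split of S2 `PlateauBound`

RH-FREE throughout (statements about the sos-cert/v1 certificate FORMAT; nothing here bears on the
truth of RH).  sos-theory g20, note 3 (`HOME/sos/theory/SCREW-P3-PLATEAU-NOTE-g20.md`).

* `remainder_divisor_pair` : for a factorisation `m = m'·m''` of a node (`(i+2) = (j+2)(l+2)`),
  `R i j + R i l = R i i − wJ` — EXACT, for every manifest remainder, every height (the lag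
  `log m − log m'` is the node `log m''`, so the profile value there is the node error of `m''`).
* `remainder_square` : `m = m'²` gives `R i j = (R i i − wJ)/2`.
* `diag_bounds_of_two_pairs` : under STRICT diagonal dominance, a row with two factor pairs having
  four distinct partners has `2wJ/3 < R i i < 2wJ`.
* the split `PlateauBound ⟸ JBound ∧ FactorPoorPlateau` (`plateauBound_of_jBound`): on factor-rich
  rows the plateau bound IS the bound `wJ = O(1/(n+1))`; what remains of S2 is the all-ones weight
  (`JBound`, slot S2a) and the factor-poor top rows `m ∈ {p, p², p³, pq}` (`FactorPoorPlateau`, S2b).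
  Conversely `2wJ < 3·R i i` on any factor-rich row, so `JBound` is also NECESSARY for `PlateauBound`.
-/

set_option linter.dupNamespace false
set_option autoImplicit false

namespace Summit.RiemannHypothesis.RiemannHypothesis.Theorems.IntegerScrew.Manifest

open Finset

/-- Node difference along a factorisation `(i+2) = (j+2)(l+2)`: `log m − log m' = log m''`. -/
theorem node_sub_node_of_mul (n : ℕ) (i j l : Fin n)
    (h : (i : ℕ) + 2 = ((j : ℕ) + 2) * ((l : ℕ) + 2)) :
    node n i - node n j = node n l := by
  unfold node
  have hj : (0 : ℝ) < (((j : ℕ) + 2 : ℕ) : ℝ) := Nat.cast_pos.mpr (by omega)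
  have hl : (0 : ℝ) < (((l : ℕ) + 2 : ℕ) : ℝ) := Nat.cast_pos.mpr (by omega)
  have hc : (((i : ℕ) + 2 : ℕ) : ℝ) = (((j : ℕ) + 2 : ℕ) : ℝ) * (((l : ℕ) + 2 : ℕ) : ℝ) := by
    exact_mod_cast h
  rw [hc, Real.log_mul hj.ne' hl.ne']
  ring

/-- **DIVISOR-PAIR IDENTITY** (RH-FREE, height-free, exact): along a factorisation
`(i+2) = (j+2)(l+2)` of a node, `R i j + R i l = R i i − wJ` for EVERY manifest remainder. -/
theorem remainder_divisor_pair (n K : ℕ) (t w : Fin K → ℝ) (wJ : ℝ) (i j l : Fin n)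
    (h : (i : ℕ) + 2 = ((j : ℕ) + 2) * ((l : ℕ) + 2)) :
    remainder n K t w wJ i j + remainder n K t w wJ i l = remainder n K t w wJ i i - wJ := by
  have h1 : node n i - node n j = node n l := node_sub_node_of_mul n i j l h
  have h2 : node n i - node n l = node n j :=
    node_sub_node_of_mul n i l j (by rw [h]; ring)
  rw [remainder_apply_remainderFn, remainder_apply_remainderFn n K t w wJ i l,
    remainder_apply_remainderFn n K t w wJ i i, h1, h2, sub_self, remainderFn_zero]
  ring

/-- Square case `(i+2) = (j+2)²`: `R i j = (R i i − wJ)/2`. -/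
theorem remainder_square (n K : ℕ) (t w : Fin K → ℝ) (wJ : ℝ) (i j : Fin n)
    (h : (i : ℕ) + 2 = ((j : ℕ) + 2) * ((j : ℕ) + 2)) :
    remainder n K t w wJ i j = (remainder n K t w wJ i i - wJ) / 2 := by
  have := remainder_divisor_pair n K t w wJ i j j h
  linarith

/-- **Two factor pairs pin the diagonal to the all-ones weight** (RH-FREE): if row `i` has
factorisations `(i+2) = (j₁+2)(l₁+2) = (j₂+2)(l₂+2)` with `j₁, l₁, j₂, l₂` pairwise distinct and the
remainder is strictly diagonally dominant, then `2wJ/3 < R i i < 2wJ`. -/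
theorem diag_bounds_of_two_pairs (n K : ℕ) (t w : Fin K → ℝ) (wJ : ℝ)
    (hD : IsStrictDiagDominant (remainder n K t w wJ)) (i j₁ l₁ j₂ l₂ : Fin n)
    (h₁ : (i : ℕ) + 2 = ((j₁ : ℕ) + 2) * ((l₁ : ℕ) + 2))
    (h₂ : (i : ℕ) + 2 = ((j₂ : ℕ) + 2) * ((l₂ : ℕ) + 2))
    (hd : j₁ ≠ l₁ ∧ j₁ ≠ j₂ ∧ j₁ ≠ l₂ ∧ l₁ ≠ j₂ ∧ l₁ ≠ l₂ ∧ j₂ ≠ l₂) :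
    remainder n K t w wJ i i < 2 * wJ ∧ 2 * wJ < 3 * remainder n K t w wJ i i := by
  obtain ⟨d1, d2, d3, d4, d5, d6⟩ := hd
  have lt₁ : (j₁ : ℕ) < i := by nlinarith [Nat.zero_le (l₁ : ℕ), Nat.zero_le (j₁ : ℕ)]
  have lt₂ : (l₁ : ℕ) < i := by nlinarith [Nat.zero_le (l₁ : ℕ), Nat.zero_le (j₁ : ℕ)]
  have lt₃ : (j₂ : ℕ) < i := by nlinarith [Nat.zero_le (l₂ : ℕ), Nat.zero_le (j₂ : ℕ)]
  have lt₄ : (l₂ : ℕ) < i := by nlinarith [Nat.zero_le (l₂ : ℕ), Nat.zero_le (j₂ : ℕ)]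
  have hsub : ({j₁, l₁, j₂, l₂} : Finset (Fin n)) ⊆ univ.erase i := by
    intro x hx
    simp only [Finset.mem_insert, Finset.mem_singleton] at hx
    rw [Finset.mem_erase]
    refine ⟨?_, Finset.mem_univ _⟩
    rcases hx with rfl | rfl | rfl | rfl
    · exact ne_of_apply_ne Fin.val (Nat.ne_of_lt lt₁)
    · exact ne_of_apply_ne Fin.val (Nat.ne_of_lt lt₂)
    · exact ne_of_apply_ne Fin.val (Nat.ne_of_lt lt₃)
    · exact ne_of_apply_ne Fin.val (Nat.ne_of_lt lt₄)
  have hsum4 : ∑ x ∈ ({j₁, l₁, j₂, l₂} : Finset (Fin n)), |remainder n K t w wJ i x|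
      = |remainder n K t w wJ i j₁| + |remainder n K t w wJ i l₁|
        + |remainder n K t w wJ i j₂| + |remainder n K t w wJ i l₂| := by
    rw [Finset.sum_insert (by simp [d1, d2, d3]), Finset.sum_insert (by simp [d4, d5]),
      Finset.sum_pair d6]
    ring
  have hle : ∑ x ∈ ({j₁, l₁, j₂, l₂} : Finset (Fin n)), |remainder n K t w wJ i x|
      ≤ ∑ x ∈ univ.erase i, |remainder n K t w wJ i x| :=
    Finset.sum_le_sum_of_subset_of_nonneg hsub (fun _ _ _ => abs_nonneg _)
  have hDi := hD i
  have p₁ := remainder_divisor_pair n K t w wJ i j₁ l₁ h₁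
  have p₂ := remainder_divisor_pair n K t w wJ i j₂ l₂ h₂
  have a₁ : |remainder n K t w wJ i i - wJ|
      ≤ |remainder n K t w wJ i j₁| + |remainder n K t w wJ i l₁| := by
    rw [← p₁]; exact abs_add_le _ _
  have a₂ : |remainder n K t w wJ i i - wJ|
      ≤ |remainder n K t w wJ i j₂| + |remainder n K t w wJ i l₂| := by
    rw [← p₂]; exact abs_add_le _ _
  have key : 2 * |remainder n K t w wJ i i - wJ| < remainder n K t w wJ i i := by linarith
  constructor
  · linarith [le_abs_self (remainder n K t w wJ i i - wJ)]
  · linarith [neg_abs_le (remainder n K t w wJ i i - wJ)]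

/-- `m` is FACTOR-RICH: it has two factorisations `m = a·b = c·d` into factors `≥ 2` with
`a, b, c, d` pairwise distinct (equivalently `d(m) ≥ 6`, e.g. `12 = 2·6 = 3·4`, `p²q`, `pqr`;
NOT factor-rich: `p, p², p³, pq`). -/
def FactorRich (m : ℕ) : Prop :=
  ∃ a b c d : ℕ, 2 ≤ a ∧ 2 ≤ b ∧ 2 ≤ c ∧ 2 ≤ d ∧ a * b = m ∧ c * d = m ∧
    a ≠ b ∧ a ≠ c ∧ a ≠ d ∧ b ≠ c ∧ b ≠ d ∧ c ≠ d

example : FactorRich 12 := ⟨2, 6, 3, 4, by omega⟩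

/-- **On a factor-rich row the diagonal is pinned: `2wJ/3 < R i i < 2wJ`** (RH-FREE, height-free). -/
theorem diag_bounds_of_factorRich (n K : ℕ) (t w : Fin K → ℝ) (wJ : ℝ)
    (hD : IsStrictDiagDominant (remainder n K t w wJ)) (i : Fin n)
    (hrich : FactorRich ((i : ℕ) + 2)) :
    remainder n K t w wJ i i < 2 * wJ ∧ 2 * wJ < 3 * remainder n K t w wJ i i := by
  obtain ⟨a, b, c, d, ha, hb, hc, hd, hab, hcd, n1, n2, n3, n4, n5, n6⟩ := hrich
  have hi : (i : ℕ) < n := i.isLt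
  have la : a - 2 < n := by
    have : a * 2 ≤ a * b := Nat.mul_le_mul_left a hb
    omega
  have lb : b - 2 < n := by
    have : 2 * b ≤ a * b := Nat.mul_le_mul_right b ha
    omega
  have lc : c - 2 < n := by
    have : c * 2 ≤ c * d := Nat.mul_le_mul_left c hd
    omega
  have ld : d - 2 < n := by
    have : 2 * d ≤ c * d := Nat.mul_le_mul_right d hc
    omega
  refine diag_bounds_of_two_pairs n K t w wJ hD i ⟨a - 2, la⟩ ⟨b - 2, lb⟩ ⟨c - 2, lc⟩ ⟨d - 2, ld⟩
    ?_ ?_ ⟨?_, ?_, ?_, ?_, ?_, ?_⟩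
  · show (i : ℕ) + 2 = (a - 2 + 2) * (b - 2 + 2)
    rw [Nat.sub_add_cancel ha, Nat.sub_add_cancel hb, hab]
  · show (i : ℕ) + 2 = (c - 2 + 2) * (d - 2 + 2)
    rw [Nat.sub_add_cancel hc, Nat.sub_add_cancel hd, hcd]
  all_goals
    intro e
    simp only [Fin.mk.injEq] at e
    omega

/-- RH-FREE conjecture slot **S2a (J-BOUND)**: the all-ones weight of a strictly diagonally dominant
manifest certificate at height `θ(n+1)` is `O_θ(1/(n+1))`.  Census (threshold cells): `wJ·M = 0.240 (64),
0.230 (128), 0.222 (160)` at the DD threshold `θ ≈ 4.0–4.1` — flat/falling.  Why it might fail: a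
high-slack certificate family at LARGE `θ` trading second moment below `θ(n+1)` for all-ones weight
(cheapest falsifier: the LP `max wJ s.t. strict DD` at `M = 32…64`, `θ = 8, 16`). -/
def JBound : Prop :=
  ∀ θ : ℝ, 0 < θ → ∃ A : ℝ, ∀ (n K : ℕ) (t w : Fin K → ℝ) (wJ : ℝ),
    (∀ k, 0 < t k ∧ t k ≤ θ * (n + 1) ∧ 0 ≤ w k) → 0 ≤ wJ →
      IsStrictDiagDominant (remainder n K t w wJ) → wJ ≤ A / (n + 1)

/-- RH-FREE conjecture slot **S2b (FACTOR-POOR PLATEAU)**: `PlateauBound` restricted to the top rows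
`m = i + 2` that are NOT factor-rich (`m ∈ {p, p², p³, pq}`: the rows with private lags).  Census at
`160@655`: the binding / dual-heavy rows are exactly such rows (`159 = 3·53, 155 = 5·31, 157, 153`),
with `diag·M = 0.2198` like every other top row.  Why it might fail: as for `PlateauBound` — a large
positive node error on a prime node paid for on its private lags `log(p/m')`. -/
def FactorPoorPlateau : Prop :=
  ∀ θ : ℝ, 0 < θ → ∃ A : ℝ, ∀ (n K : ℕ) (t w : Fin K → ℝ) (wJ : ℝ),
    (∀ k, 0 < t k ∧ t k ≤ θ * (n + 1) ∧ 0 ≤ w k) → 0 ≤ wJ →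
      IsStrictDiagDominant (remainder n K t w wJ) →
        ∀ i : Fin n, n ≤ 4 * ((i : ℕ) + 2) → ¬ FactorRich ((i : ℕ) + 2) →
          remainder n K t w wJ i i ≤ A / (n + 1)

/-- **The split of S2 (RH-FREE, proved): `JBound → FactorPoorPlateau → PlateauBound`.** -/
theorem plateauBound_of_jBound (hJ : JBound) (hP : FactorPoorPlateau) : PlateauBound := by
  intro θ hθ
  obtain ⟨AJ, hAJ⟩ := hJ θ hθ
  obtain ⟨AP, hAP⟩ := hP θ hθ
  refine ⟨max (2 * AJ) AP, ?_⟩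
  intro n K t w wJ ht hwJ hD i hi
  have hn : (0 : ℝ) < (n : ℝ) + 1 := by positivity
  by_cases hrich : FactorRich ((i : ℕ) + 2)
  · have h1 := (diag_bounds_of_factorRich n K t w wJ hD i hrich).1
    have h2 := hAJ n K t w wJ ht hwJ hD
    have h3 : 2 * AJ / ((n : ℝ) + 1) ≤ max (2 * AJ) AP / ((n : ℝ) + 1) :=
      div_le_div_of_nonneg_right (le_max_left _ _) hn.le
    have h4 : 2 * (AJ / ((n : ℝ) + 1)) = 2 * AJ / ((n : ℝ) + 1) := by ring
    linarith
  · have h2 := hAP n K t w wJ ht hwJ hD i hi hrich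
    have h3 : AP / ((n : ℝ) + 1) ≤ max (2 * AJ) AP / ((n : ℝ) + 1) :=
      div_le_div_of_nonneg_right (le_max_right _ _) hn.le
    linarith

/-- **Every strictly-DD manifest certificate with a factor-rich row has `wJ > 0`** (RH-FREE,
height-free): the all-ones atom is NECESSARY in the format as soon as `n + 1 ≥ 12`. -/
theorem wJ_pos_of_factorRich (n K : ℕ) (t w : Fin K → ℝ) (wJ : ℝ)
    (hD : IsStrictDiagDominant (remainder n K t w wJ)) (i : Fin n)
    (hrich : FactorRich ((i : ℕ) + 2)) : 0 < wJ := by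
  have h1 := (diag_bounds_of_factorRich n K t w wJ hD i hrich).1
  have h2 : 0 ≤ ∑ j ∈ univ.erase i, |remainder n K t w wJ i j| :=
    sum_nonneg fun _ _ => abs_nonneg _
  have h3 := hD i
  linarith

/-- Necessity of the J-bound on any factor-rich row (RH-FREE): `wJ < (3/2)·R i i`. -/
theorem wJ_lt_of_factorRich (n K : ℕ) (t w : Fin K → ℝ) (wJ : ℝ)
    (hD : IsStrictDiagDominant (remainder n K t w wJ)) (i : Fin n)
    (hrich : FactorRich ((i : ℕ) + 2)) :
    wJ < 3 / 2 * remainder n K t w wJ i i := by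
  have := (diag_bounds_of_factorRich n K t w wJ hD i hrich).2
  linarith


end Summit.RiemannHypothesis.RiemannHypothesis.Theorems.IntegerScrew.Manifest
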